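import Literature.Computability.AlgebraicComplexity.IK20HighestWeightVectors
import Literature.Computability.AlgebraicComplexity.BI17PowerSumStabilizerProofs
import Literature.NumberTheory.DiophantineGeometry.GLHighestWeightIsomorphismProofs
import Literature.NumberTheory.DiophantineGeometry.GLPolynomialRepSemisimpleProofs
import Literature.NumberTheory.DiophantineGeometry.SchurWeylPlethysmIrreducibleProofs
import Literature.NumberTheory.DiophantineGeometry.SchurWeylHighestWeightProofs
import Literature.NumberTheory.DiophantineGeometry.SchurWeylPlethysmPolynomialProofs
import Literature.NumberTheory.DiophantineGeometry.GLHighestWeightFacts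
import Mathlib.LinearAlgebra.PiTensorProduct.Finite
import HarnessLib

/-!
# Ikenmeyer–Kandasamy 2020, Lemma 5.1 (the shift lemma of [BI:17]) — proofs

Discharge of the named fact `IK2020_lemma_5_1` (`IK20HighestWeightVectors.lean`; cell `val-lit`,
row IK2020-A; honest framing: bookkeeping of a printed statement about the toy model
`p = x₁^D + ⋯ + x_m^D`; VP ≠ VNP is NOT proved and nothing here is progress on it).

Printed statement (C. Ikenmeyer, U. Kandasamy, STOC 2020 = arXiv:1911.03990, Lemma 5.1, TeX
L506–509, quoted there from [BI:17] = Bürgisser–Ikenmeyer, *Fundamental invariants of orbit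
closures*, J. Algebra 477 (2017)): "If `D` is even, then `mult_{λ^*} ℂ[Gp] = mult_{(λ+(m×D))^*} ℂ[Gp]`.
If `D` is odd, then `mult_{λ^*} ℂ[Gp] = mult_{(λ+(m×2D))^*} ℂ[Gp]`." As typed (rendering of
`mult_{λ^*} ℂ[Gp]` through IK's (9.3)–(9.4) as `dim {λ}^H`, `H = stab p`, see the module docstring of
`IK20HighestWeightVectors.lean`): `dim {λ}^H = dim {λ + (m × D)}^H` resp. `… (m × 2D)`.

## The printed argument (BI 2017, proof of Thm. 3.2(2), TeX L744–756, and Prop. 2.4(2))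

* `V(λ + (m × ℓ)) = V(λ) ⊗ det^ℓ` as `GL_m`-modules; hence for a subgroup `H ≤ GL_m` on which
  `det^ℓ` is trivial, `V(λ + (m × ℓ))^H ≃ V(λ)^H`.
* BI 2017, Prop. 2.4(2): the stabilizer of `x₁^D + ⋯ + x_m^D` (`D ≥ 3`, `m ≥ 2`) is generated by
  the permutation matrices and the diagonal matrices of `D`-th roots of unity, so its image under
  `det` is `μ_D` (`D` even) resp. `μ_{2D}` (`D` odd): the stabilizer period is `D` resp. `2D`.

## Formalization

* §1 `detTwist ℓ ρ` (tree, `GLPolynomialRepSemisimpleProofs.lean`: `g ↦ det(g)^ℓ • ρ g`) keeps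
  irreducibility (tree `subrepresentationDetTwistOrderIso`) and polynomiality, and shifts highest
  weights by `(ℓ, …, ℓ)`.
* §2 the weight of IK's `addRect λ m ℓ` (`λ + (m × ℓ)`) is `(λ₁ + ℓ, …, λ_m + ℓ)`.
* §3 `{λ + (m × ℓ)} ≃ {λ} ⊗ det^ℓ`: both are irreducible rational representations with the same
  highest weight (tree: `isIrreducible_weylRep_holds`, `hasHighestWeight_weylRep_iff_holds`,
  `isPolynomialRep_weylRep_holds`), hence isomorphic by the tree's highest-weight isomorphism
  theorem `nonempty_equiv_of_hasHighestWeight_holds` (algebraically closed field of characteristic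
  zero). This replaces the character-theoretic identification of the printed source.
* §4 invariants: for `H ≤ GL_m` with `det(h)^ℓ = 1` on `H`, the equivalence of §3 restricts to
  `{λ + (m × ℓ)}^H ≃ {λ}^H`, so `weylInvariantDim` agrees.
* §5 `det(h)^D = 1` (`D` even), `det(h)^{2D} = 1` (`D` odd) on `H = stab(x₁^D + ⋯ + x_m^D)` from
  BI 2017 Prop. 2.4(2) (`BI2017_prop_2_4_2`).
* §6 assembly `IK2020_lemma_5_1_holds`.

## References

* C. Ikenmeyer, U. Kandasamy, STOC 2020 = arXiv:1911.03990, Lemma 5.1. [IkenmeyerKandasamy2019]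
* P. Bürgisser, C. Ikenmeyer, J. Algebra 477 (2017), Prop. 2.4(2) and proof of Thm. 3.2.
  [BurgisserIkenmeyer2017]
* W. Fulton, J. Harris, *Representation Theory*, GTM 129, Thm. 14.18, Prop. 15.47.
  [FultonHarrisGTM129]
-/

noncomputable section

open MvPolynomial
open scoped BigOperators

namespace Literature.Computability.AlgebraicComplexity

open _root_.Literature.NumberTheory.DiophantineGeometry

namespace IK2020

/-! ### §1 Twisting by a power of the determinant -/

section DetTwist

variable {σ k V : Type*} [Fintype σ] [LinearOrder σ] [Field k] [AddCommGroup V] [Module k V]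

/-- `detTwist ℓ ρ g v = det(g)^ℓ • ρ g v` (unfolding lemma; private helper). [folklore] -/
private theorem detTwist_apply_apply (ℓ : ℕ) (ρ : Representation k (GL σ k) V) (g : GL σ k) (v : V) :
    detTwist ℓ ρ g v = ((g : Matrix σ σ k).det ^ ℓ) • ρ g v := by
  rw [detTwist_apply, LinearMap.smul_apply]

/-- Twisting by `D_ℓ = det^ℓ` ("the one-dimensional representation of `GL_n ℂ` given by the
`k`th power of the determinant", Fulton–Harris §15.5) preserves irreducibility (same stable
subspaces; tree `subrepresentationDetTwistOrderIso`). [cite: FultonHarrisGTM129, §15.5] -/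
theorem isIrreducible_detTwist (ℓ : ℕ) (ρ : Representation k (GL σ k) V) [ρ.IsIrreducible] :
    (detTwist ℓ ρ).IsIrreducible :=
  (subrepresentationDetTwistOrderIso ℓ ρ).isSimpleOrder

/-- Twisting a polynomial representation by `D_ℓ = det^ℓ` (`ℓ ≥ 0`: "`D_k = (∧^n V)^{⊗k}`",
Fulton–Harris §15.5) gives a polynomial representation (multiply the matrix coefficient by the
generic determinant to the `ℓ`-th power). [cite: FultonHarrisGTM129, §15.5] -/
theorem isPolynomialRep_detTwist (ℓ : ℕ) {ρ : Representation k (GL σ k) V}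
    (hρ : IsPolynomialRep ρ) : IsPolynomialRep (detTwist ℓ ρ) := by
  intro v φ
  obtain ⟨P, hP⟩ := hρ v φ
  refine ⟨(Matrix.mvPolynomialX σ σ k).det ^ ℓ * P, fun g => ?_⟩
  rw [detTwist_apply_apply, map_smul, smul_eq_mul, hP g, map_mul, map_pow,
    Matrix.eval_det_mvPolynomialX]
  rfl

/-- The weight character of the shifted weight `χ + (ℓ, …, ℓ)` on an upper triangular `g` is
`det(g)^ℓ · χ(g)` (`det g = ∏ g_ii`; Fulton–Harris §15.5: tensoring with `D_k` shifts
`(λ₁, …, λ_n)` to `(λ₁ + k, …, λ_n + k)`). [cite: FultonHarrisGTM129, §15.5] -/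
theorem weightChar_add_const {g : GL σ k} (hg : IsUpperTriangular g) (χ : Weight σ) (ℓ : ℕ) :
    weightChar (fun i => χ i + ℓ) g = (g : Matrix σ σ k).det ^ ℓ * weightChar χ g := by
  unfold weightChar
  rw [Matrix.det_of_upperTriangular hg, ← Finset.prod_pow, ← Finset.prod_mul_distrib]
  refine Finset.prod_congr rfl fun i _ => ?_
  rw [zpow_add₀ (diag_ne_zero_of_isUpperTriangular hg i), zpow_natCast, mul_comm]

/-- A highest-weight vector of weight `χ` of `ρ` is a highest-weight vector of weight
`χ + (ℓ, …, ℓ)` of `ρ ⊗ D_ℓ` (Fulton–Harris §15.5, "`Ψ_{λ₁+k,…,λ_n+k} = Ψ_{λ₁,…,λ_n} ⊗ D_k`").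
[cite: FultonHarrisGTM129, §15.5] -/
theorem highestWeightSpace_le_detTwist (ℓ : ℕ) (ρ : Representation k (GL σ k) V) (χ : Weight σ) :
    highestWeightSpace ρ χ ≤ highestWeightSpace (detTwist ℓ ρ) (fun i => χ i + ℓ) := by
  intro v hv g hg
  rw [detTwist_apply_apply, hv g hg, smul_smul, weightChar_add_const hg]

/-- `ρ ⊗ D_ℓ` has the highest weight `χ + (ℓ, …, ℓ)` if `ρ` has the highest weight `χ`
(Fulton–Harris §15.5). [cite: FultonHarrisGTM129, §15.5] -/
theorem hasHighestWeight_detTwist (ℓ : ℕ) {ρ : Representation k (GL σ k) V} {χ : Weight σ}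
    (h : HasHighestWeight ρ χ) : HasHighestWeight (detTwist ℓ ρ) (fun i => χ i + ℓ) := by
  rw [hasHighestWeight_iff_exists] at h ⊢
  obtain ⟨v, hv0, hv⟩ := h
  exact ⟨v, hv0, highestWeightSpace_le_detTwist ℓ ρ χ hv⟩

/-- On a subgroup `H ≤ GL σ k` on which `det^ℓ` is trivial, `ρ ⊗ det^ℓ` and `ρ` have the same
invariants (BI 2017, proof of Thm. 3.2(2): "`dim V_G(λ)^{stab(w)}` is nonzero iff `det(g)^ℓ = 1` for
all `g ∈ stab(w)`" for the character `det^ℓ`). [cite: BurgisserIkenmeyer2017, proof of Thm. 3.2(2)] -/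
theorem invariants_detTwist_comp_subtype (ℓ : ℕ) (ρ : Representation k (GL σ k) V)
    (H : Subgroup (GL σ k)) (hH : ∀ h ∈ H, ((h : Matrix σ σ k).det) ^ ℓ = 1) :
    Representation.invariants ((detTwist ℓ ρ).comp H.subtype) =
      Representation.invariants (ρ.comp H.subtype) := by
  refine Submodule.ext fun v => ?_
  simp only [Representation.mem_invariants, MonoidHom.coe_comp, Function.comp_apply,
    Subgroup.coe_subtype]
  refine forall_congr' fun h => ?_
  rw [detTwist_apply_apply, hH h h.2, one_smul]

/-- Invariants of a subgroup (or of any group mapping to `G`) are transported along an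
equivalence of representations (private plumbing helper). [folklore] -/
private theorem invariants_comp_map_equiv {G H W : Type*} [Group G] [Group H] [AddCommGroup W]
    [Module k W] {ρ : Representation k G V} {ρ' : Representation k G W} (e : ρ.Equiv ρ')
    (f : H →* G) :
    (Representation.invariants (ρ.comp f)).map e.toLinearEquiv.toLinearMap =
      Representation.invariants (ρ'.comp f) := by
  apply le_antisymm
  · refine Submodule.map_le_iff_le_comap.2 fun v hv => ?_
    rw [Representation.mem_invariants] at hv
    rw [Submodule.mem_comap, Representation.mem_invariants]
    intro x
    change ρ' (f x) (e.toLinearEquiv v) = e.toLinearEquiv v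
    rw [Representation.Equiv.toLinearEquiv_apply, ← e.toIntertwiningMap.isIntertwining]
    exact congrArg _ (hv x)
  · intro w hw
    rw [Representation.mem_invariants] at hw
    refine ⟨e.toLinearEquiv.symm w, ?_, e.toLinearEquiv.apply_symm_apply w⟩
    rw [SetLike.mem_coe, Representation.mem_invariants]
    intro x
    apply e.toLinearEquiv.injective
    change e.toLinearEquiv (ρ (f x) (e.toLinearEquiv.symm w)) = _
    rw [Representation.Equiv.toLinearEquiv_apply, e.toIntertwiningMap.isIntertwining,
      ← Representation.Equiv.toLinearEquiv_apply, LinearEquiv.apply_symm_apply]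
    exact hw x

end DetTwist

/-! ### §2 The weight of `λ + (m × ℓ)` -/

section AddRect

variable {n : ℕ}

/-- `λ + (m × ℓ)` has at most `m` parts (IK §3, TeX L312–313: "`λ + μ`", "`a × b := (b, …, b)` with
`a` rows"). [cite: IkenmeyerKandasamy2019, §3] -/
theorem card_parts_addRect_le (lam : Nat.Partition n) (m ℓ : ℕ) (h : lam.parts.card ≤ m) :
    (addRect lam m ℓ h).parts.card ≤ m := by
  rw [addRect, Nat.Partition.ofSums_parts]
  refine (Multiset.card_le_card (Multiset.filter_le _ _)).trans ?_
  rw [Multiset.card_add, Multiset.card_map, Multiset.card_replicate]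
  omega

/-- For `ℓ > 0` the parts of `λ + (m × ℓ)` are `λ₁ + ℓ, …, λ_r + ℓ` followed by `m - r` parts
`ℓ` (`r` the number of parts of `λ`; private helper). [folklore] -/
private theorem parts_addRect_eq_coe (lam : Nat.Partition n) (m ℓ : ℕ) (h : lam.parts.card ≤ m)
    (hℓ : 0 < ℓ) :
    (addRect lam m ℓ h).parts =
      ((lam.sortedParts.map (· + ℓ) ++ List.replicate (m - lam.parts.card) ℓ : List ℕ) :
        Multiset ℕ) := by
  rw [addRect, Nat.Partition.ofSums_parts, Multiset.filter_eq_self.2, ← Multiset.coe_add,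
    ← Multiset.map_coe, ← Multiset.coe_replicate]
  · congr 2
    rw [Nat.Partition.sortedParts, Multiset.sort_eq]
  · intro a ha
    rcases Multiset.mem_add.1 ha with ha | ha
    · obtain ⟨b, -, rfl⟩ := Multiset.mem_map.1 ha
      omega
    · rw [Multiset.eq_of_mem_replicate ha]
      omega

/-- For `ℓ > 0` the sorted parts of `λ + (m × ℓ)` (private helper). [folklore] -/
private theorem sortedParts_addRect (lam : Nat.Partition n) (m ℓ : ℕ) (h : lam.parts.card ≤ m)
    (hℓ : 0 < ℓ) :
    (addRect lam m ℓ h).sortedParts =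
      lam.sortedParts.map (· + ℓ) ++ List.replicate (m - lam.parts.card) ℓ := by
  change (addRect lam m ℓ h).parts.sort (· ≥ ·) = _
  rw [parts_addRect_eq_coe lam m ℓ h hℓ, Multiset.coe_sort]
  refine List.mergeSort_eq_self _ ?_
  rw [List.pairwise_append]
  refine ⟨lam.sortedGE_sortedParts.pairwise.map _ fun a b hab => ?_, ?_, fun a ha b hb => ?_⟩
  · exact Nat.add_le_add_right hab ℓ
  · exact List.pairwise_replicate.2 (Or.inr le_rfl)
  · obtain ⟨c, -, rfl⟩ := List.mem_map.1 ha
    rw [List.eq_of_mem_replicate hb]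
    omega

/-- **The rows of `λ + (m × ℓ)` are `λ_i + ℓ`** (`i < m`). IK §3, TeX L312–313 ("`(λ+μ)_i := λ_i +
μ_i`"). [cite: IkenmeyerKandasamy2019, §3] -/
theorem getD_sortedParts_addRect (lam : Nat.Partition n) (m ℓ : ℕ) (h : lam.parts.card ≤ m)
    {i : ℕ} (hi : i < m) :
    (addRect lam m ℓ h).sortedParts.getD i 0 = lam.sortedParts.getD i 0 + ℓ := by
  rcases Nat.eq_zero_or_pos ℓ with rfl | hℓ
  · -- `ℓ = 0`: the parts are those of `λ`
    have hp : (addRect lam m 0 h).parts = lam.parts := by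
      rw [addRect, Nat.Partition.ofSums_parts, Multiset.filter_add]
      have h1 : Multiset.filter (fun x => x ≠ 0) (lam.parts.map (· + 0)) = lam.parts := by
        rw [Multiset.filter_eq_self.2]
        · simp
        · intro a ha
          obtain ⟨b, hb, rfl⟩ := Multiset.mem_map.1 ha
          exact (Nat.add_pos_left (lam.parts_pos hb) 0).ne'
      have h2 : Multiset.filter (fun x => x ≠ 0) (Multiset.replicate (m - lam.parts.card) 0) = 0 :=
        Multiset.filter_eq_nil.2 fun a ha => by simp [Multiset.eq_of_mem_replicate ha]
      rw [h1, h2, add_zero]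
    rw [add_zero]
    change ((addRect lam m 0 h).parts.sort (· ≥ ·)).getD i 0 = (lam.parts.sort (· ≥ ·)).getD i 0
    rw [hp]
  · rw [sortedParts_addRect lam m ℓ h hℓ]
    have hlen : lam.sortedParts.length = lam.parts.card := lam.length_sortedParts
    by_cases hil : i < lam.sortedParts.length
    · rw [List.getD_append _ _ _ _ (by simpa using hil), List.getD_eq_getElem _ _ (by simpa using hil),
        List.getD_eq_getElem _ _ hil, List.getElem_map]
    · rw [not_lt] at hil
      have hi' : i - (lam.sortedParts.map (· + ℓ)).length <
          (List.replicate (m - lam.parts.card) ℓ).length := by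
        rw [List.length_map, List.length_replicate]
        omega
      rw [List.getD_append_right _ _ _ _ (by simpa using hil), List.getD_eq_default _ _ hil,
        zero_add, List.getD_eq_getElem _ _ hi', List.getElem_replicate]

/-- **The `GL_m`-weight of `λ + (m × ℓ)` is `(λ₁ + ℓ, …, λ_m + ℓ)`.** IK §3 (notation `λ + μ`,
`a × b`). [cite: IkenmeyerKandasamy2019, §3] -/
theorem ofPartition_addRect (lam : Nat.Partition n) (m ℓ : ℕ) (h : lam.parts.card ≤ m) :
    Weight.ofPartition m (addRect lam m ℓ h) = fun i => Weight.ofPartition m lam i + ℓ := by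
  funext i
  rw [Weight.ofPartition_apply, Weight.ofPartition_apply, getD_sortedParts_addRect lam m ℓ h i.2,
    Nat.cast_add]

end AddRect

/-! ### §3 `{λ + (m × ℓ)} ≃ {λ} ⊗ det^ℓ` -/

section TwistEquiv

variable (k : Type*) [Field k] [IsAlgClosed k] [CharZero k] {n : ℕ}

/-- **`V(λ + (m × ℓ)) ≅ V(λ) ⊗ det^ℓ`** as representations of `GL_m` (algebraically closed field of
characteristic zero): the Weyl module of `λ + (m × ℓ)` and the `det^ℓ`-twist of the Weyl module of
`λ` are irreducible rational representations with the same highest weight `(λ₁ + ℓ, …, λ_m + ℓ)`,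
hence isomorphic (tree `nonempty_equiv_of_hasHighestWeight_holds`). Printed: Fulton–Harris §15.5,
"`Ψ_{λ₁+k,…,λ_n+k} = Ψ_{λ₁,…,λ_n} ⊗ D_k`" (`Ψ_λ = S_λ V`, `D_k` = the `k`-th power of the
determinant); used in BI 2017, proof of Thm. 3.2(2). [cite: FultonHarrisGTM129, §15.5]
[cite: BurgisserIkenmeyer2017, proof of Thm. 3.2(2)] -/
theorem nonempty_equiv_weylRep_addRect_detTwist {m : ℕ} (lam : Nat.Partition n)
    (h : lam.parts.card ≤ m) (ℓ : ℕ) :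
    Nonempty ((weylRep k (Fin m) (addRect lam m ℓ h)).Equiv
      (detTwist (V := weylModule k (Fin m) lam) ℓ (weylRep k (Fin m) lam))) := by
  have hcard : (addRect lam m ℓ h).parts.card ≤ m := card_parts_addRect_le lam m ℓ h
  haveI : Representation.IsIrreducible (V := weylModule k (Fin m) (addRect lam m ℓ h))
      (weylRep k (Fin m) (addRect lam m ℓ h)) :=
    isIrreducible_weylRep_holds k (Fin m) (addRect lam m ℓ h) (by simpa using hcard)
  haveI : Representation.IsIrreducible (V := weylModule k (Fin m) lam) (weylRep k (Fin m) lam) :=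
    isIrreducible_weylRep_holds k (Fin m) lam (by simpa using h)
  haveI : Representation.IsIrreducible (V := weylModule k (Fin m) lam)
      (detTwist (V := weylModule k (Fin m) lam) ℓ (weylRep k (Fin m) lam)) :=
    isIrreducible_detTwist ℓ _
  have hrat₁ : IsRationalRep (V := weylModule k (Fin m) (addRect lam m ℓ h))
      (weylRep k (Fin m) (addRect lam m ℓ h)) :=
    (isPolynomialRep_weylRep_holds k (Fin m) (addRect lam m ℓ h)).isRationalRep
  have hrat₂ : IsRationalRep (V := weylModule k (Fin m) lam)
      (detTwist (V := weylModule k (Fin m) lam) ℓ (weylRep k (Fin m) lam)) :=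
    (isPolynomialRep_detTwist ℓ (isPolynomialRep_weylRep_holds k (Fin m) lam)).isRationalRep
  have h₁ : HasHighestWeight (V := weylModule k (Fin m) (addRect lam m ℓ h))
      (weylRep k (Fin m) (addRect lam m ℓ h)) (Weight.ofPartition m (addRect lam m ℓ h)) :=
    (hasHighestWeight_weylRep_iff_holds (k := k) (addRect lam m ℓ h) hcard _).2 rfl
  have h₂ : HasHighestWeight (V := weylModule k (Fin m) lam)
      (detTwist (V := weylModule k (Fin m) lam) ℓ (weylRep k (Fin m) lam))
      (Weight.ofPartition m (addRect lam m ℓ h)) := by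
    rw [ofPartition_addRect]
    exact hasHighestWeight_detTwist ℓ ((hasHighestWeight_weylRep_iff_holds (k := k) lam h _).2 rfl)
  exact nonempty_equiv_of_hasHighestWeight_holds hrat₁ hrat₂ h₁ h₂

/-! ### §4 Invariants -/

/-- **`dim {λ}^H = dim {λ + (m × ℓ)}^H` whenever `det^ℓ` is trivial on `H ≤ GL_m`** (the content
of IK's Lemma 5.1 / BI 2017, proof of Thm. 3.2(2): `V(λ + (m × ℓ))^H ≃ (V(λ) ⊗ det^ℓ)^H = V(λ)^H`).
[cite: BurgisserIkenmeyer2017, proof of Thm. 3.2(2)] -/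
theorem weylInvariantDim_eq_addRect {m : ℕ} (lam : Nat.Partition n) (h : lam.parts.card ≤ m)
    (ℓ : ℕ) (H : Subgroup (GL (Fin m) k))
    (hH : ∀ g ∈ H, ((g : Matrix (Fin m) (Fin m) k).det) ^ ℓ = 1) :
    weylInvariantDim k m lam H = weylInvariantDim k m (addRect lam m ℓ h) H := by
  obtain ⟨e⟩ := nonempty_equiv_weylRep_addRect_detTwist k lam h ℓ
  have h1 := invariants_detTwist_comp_subtype (V := weylModule k (Fin m) lam) ℓ
    (weylRep k (Fin m) lam) H hH
  have h2 := invariants_comp_map_equiv (V := weylModule k (Fin m) (addRect lam m ℓ h))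
    (W := weylModule k (Fin m) lam) e H.subtype
  unfold weylInvariantDim
  rw [← h1, ← h2, LinearEquiv.finrank_map_eq]

end TwistEquiv

/-! ### §5 The stabilizer of `x₁^D + ⋯ + x_m^D`: `det^D` (`D` even), `det^{2D}` (`D` odd) are trivial -/

section Period

variable {k : Type*} [Field k] [CharZero k] {m : ℕ}

/-- **`det(γ)^N = 1` on the stabilizer of `x₁^D + ⋯ + x_m^D`** for every even multiple `N` of `D`
(`D ≥ 3`, characteristic zero): by BI 2017, Prop. 2.4(2) (tree:
`exists_perm_diagonal_of_mem_linStabilizer_psum`, file `BI17PowerSumStabilizerProofs.lean`) every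
stabilizer element is a monomial matrix `P_π · diag(t)` with `t_j^D = 1`, so
`det(γ)^N = sign(π)^N (∏ t_j)^N = 1`. With `N = D` (`D` even) resp. `N = 2D` (`D` odd) this is the
statement "the stabilizer period of `X_1^D + ⋯ + X_m^D` equals `D` if `D` is even and `2D` if `D` is
odd" in the divisibility form used by IK. [cite: BurgisserIkenmeyer2017, Prop. 2.4(2)] -/
theorem det_pow_eq_one_of_mem_linStabilizer_psum {D N : ℕ} (hD : 2 < D) (hN : Even N)
    (hDN : D ∣ N) {γ : GL (Fin m) k} (hγ : γ ∈ linStabilizer (psum (Fin m) k D)) :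
    ((γ : Matrix (Fin m) (Fin m) k).det) ^ N = 1 := by
  obtain ⟨π, t, ht, hmat⟩ := exists_perm_diagonal_of_mem_linStabilizer_psum hD γ hγ
  have h1 : (((Equiv.Perm.sign π : ℤˣ) : ℤ) : k) ^ N = 1 := by
    rcases Int.units_eq_one_or (Equiv.Perm.sign π) with h | h
    · rw [h, Units.val_one, Int.cast_one, one_pow]
    · rw [h, Units.val_neg, Units.val_one, Int.cast_neg, Int.cast_one, hN.neg_one_pow]
  have h2 : (∏ i, t i) ^ N = 1 := by
    obtain ⟨c, rfl⟩ := hDN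
    rw [pow_mul, ← Finset.prod_pow]
    simp [ht]
  rw [hmat, Matrix.det_mul, Matrix.det_permutation, Matrix.det_diagonal, mul_pow, h1, h2, one_mul]

end Period

end IK2020

open IK2020 in
/-- **Discharge of `IK2020_lemma_5_1`** (Ikenmeyer–Kandasamy 2020, Lemma 5.1 = [BI:17]; TeX
L506–509): for `3 ≤ D ≤ m`, `λ ⊢_m dD` and `H = stab(x₁^D + ⋯ + x_m^D) ≤ GL_m(ℂ)`,
`dim {λ}^H = dim {λ + (m × D)}^H` if `D` is even and `dim {λ}^H = dim {λ + (m × 2D)}^H` if `D` is odd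
— the typed rendering (via IK (9.3)–(9.4)) of "`mult_{λ^*} ℂ[Gp] = mult_{(λ+(m×D))^*} ℂ[Gp]`" resp.
"`… (m × 2D)`". Proof as in BI 2017 (proof of Thm. 3.2(2) with Prop. 2.4(2)):
`{λ + (m × ℓ)} ≅ {λ} ⊗ det^ℓ` (`weylInvariantDim_eq_addRect`) and `det^D` resp. `det^{2D}` is
trivial on `H` (`det_pow_eq_one_of_mem_linStabilizer_psum`).
[cite: IkenmeyerKandasamy2019, Lemma 5.1] [cite: BurgisserIkenmeyer2017, Prop. 2.4(2)] -/
theorem IK2020_lemma_5_1_holds : IK2020_lemma_5_1 := by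
  intro m D d hD hDm lam h
  have hD' : 2 < D := by omega
  exact ⟨fun hev => weylInvariantDim_eq_addRect ℂ lam h D _ fun g hg =>
      det_pow_eq_one_of_mem_linStabilizer_psum hD' hev dvd_rfl hg,
    fun _ => weylInvariantDim_eq_addRect ℂ lam h (2 * D) _ fun g hg =>
      det_pow_eq_one_of_mem_linStabilizer_psum hD' (even_two_mul D) (dvd_mul_left D 2) hg⟩

end Literature.Computability.AlgebraicComplexity
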